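import Literature.Algebra.Polynomial.CasasAlvero.Char151Digits
import Literature.Algebra.Polynomial.CasasAlvero.Degree7Char151
import Literature.Algebra.Polynomial.CasasAlvero.Pentanomial
import Literature.Algebra.Polynomial.CasasAlvero.Degree6CandidatesPrime
import Literature.Algebra.Polynomial.CasasAlvero.FieldCorollaries
import Literature.Algebra.Polynomial.CasasAlvero.Degree5
import Literature.Algebra.Polynomial.CasasAlvero.Degree6
import Literature.Algebra.Polynomial.CasasAlvero.DigitReduction
import HarnessLib

/-!
# Casas-Alvero degrees in characteristic 151: the complete classification (seven good digits)

Over EVERY field `K` of characteristic `151`: `CA_d(K) ⟺ d = 0 ∨ d = a·151^k` with `1 ≤ a ≤ 7` — like `127`, a prime with SEVEN good digits.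
Ingredients: the digit reduction `CA_d ⇒ d = a·p^k ∧ CA_a` (`DigitReduction.lean`, any field); the positive digits `1, 2, 3, 4`
([GrafVonBothmerEtAl2007, Props. 2, 6]), `5` (`Degree5.lean`: `151` is not one of the nine bad primes of degree `5`), `6` (`151` is not among the `54`
candidate bad primes of degree `6` of `Degree6CandidatesPrime.lean`, so `CA_6` holds in characteristic `151` [CastryckLaterveerOunaies2012, Thm. 4]) and `7`
(`Degree7Char151.lean`: `151` is a GOOD prime for degree `7` — the kernel-checked scenario certificates `holdsInDegree_seven_of_char_151`; the bad primes of
degree `7` were computed in [CastryckLaterveerOunaies2012, Thm. 4] — with `CA_{7·151^k}` descending from the algebraic closure); and a refutation of every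
digit `8 ≤ a ≤ 150` over every field of characteristic `151`:
`19, 26, 44, 49, 57, 59, 71, 75, 78, 82, 83, 88, 99, 102, 110, 114, 123, 125, 127, 128, 129, 130, 140, 142, 145, 146, 150` by the binomial criterion
(`m = 5, 4, 8, 23, 21, 27, 25, 24, 10, 10, 32, 19, 24, 37, 7, 8, 32, 46, 21, 4, 23, 7, 68, 9, 14, 22, 2`); and the 116 remaining digits by the sparse `𝔽_151`-examples of `Char151Digits.lean`.
-/

noncomputable section

open Polynomial

set_option maxRecDepth 8192

namespace Literature.Algebra.Polynomial.CasasAlvero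

section CharOneHundredFiftyOne

variable (K : Type*) [Field K] [CharP K 151]

/-- `CA_{6·151^k}` over every field of characteristic `151` (`CA_6` itself — the case `k = 0` — holds because `151` is not among the
`54` candidate bad primes of degree `6` of `Degree6CandidatesPrime.lean`, `holdsInDegree_six_of_not_mem`, i.e. `151` is a GOOD prime for degree `6`
[cite: CastryckLaterveerOunaies2012, Thm. 4]). [cite: GrafVonBothmerEtAl2007, Prop. 6] -/
theorem holdsInDegree_six_mul_pow_of_char_151' (k : ℕ) : HoldsInDegree K (6 * 151 ^ k) := by
  haveI : Fact (Nat.Prime 151) := ⟨by norm_num⟩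
  exact holdsInDegree_mul_prime_pow_field K 151 (holdsInDegree_six_of_not_mem (K := AlgebraicClosure K) 151 (by decide)) k

set_option maxHeartbeats 1000000 in
/-- every digit `8 ≤ a < 151` fails: `¬ CA_a` over every field of characteristic `151` — the bad-prime computations of
[cite: CastryckLaterveerOunaies2012, Thm. 4] (degrees `≤ 7`) extended to every digit `8 ≤ a < 151` by explicit `𝔽_151`-rational examples and the
binomial criterion. [cite: GrafVonBothmerEtAl2007, Prop. 6] -/
theorem not_holdsInDegree_digit_of_char_oneHundredFiftyOne {a : ℕ} (h8 : 8 ≤ a) (hap : a < 151) : ¬ HoldsInDegree K a := by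
  haveI : Fact (Nat.Prime 151) := ⟨by norm_num⟩
  interval_cases a
  · exact not_holdsInDegree_eight_of_char_151 K
  · exact not_holdsInDegree_nine_of_char_151 K
  · exact not_holdsInDegree_ten_of_char_151 K
  · exact not_holdsInDegree_eleven_of_char_151 K
  · exact not_holdsInDegree_twelve_of_char_151 K
  · exact not_holdsInDegree_thirteen_of_char_151 K
  · exact not_holdsInDegree_fourteen_of_char_151 K
  · exact not_holdsInDegree_fifteen_of_char_151 K
  · exact not_holdsInDegree_sixteen_of_char_151 K
  · exact not_holdsInDegree_seventeen_of_char_151 K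
  · exact not_holdsInDegree_eighteen_of_char_151 K
  · exact not_holdsInDegree_of_choose_modEq_one K 151 (d := 19) (m := 5) (by norm_num) (by norm_num) (by decide)
  · exact not_holdsInDegree_twenty_of_char_151 K
  · exact not_holdsInDegree_twentyOne_of_char_151 K
  · exact not_holdsInDegree_twentyTwo_of_char_151 K
  · exact not_holdsInDegree_twentyThree_of_char_151 K
  · exact not_holdsInDegree_twentyFour_of_char_151 K
  · exact not_holdsInDegree_twentyFive_of_char_151 K
  · exact not_holdsInDegree_of_choose_modEq_one K 151 (d := 26) (m := 4) (by norm_num) (by norm_num) (by decide)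
  · exact not_holdsInDegree_twentySeven_of_char_151 K
  · exact not_holdsInDegree_twentyEight_of_char_151 K
  · exact not_holdsInDegree_twentyNine_of_char_151 K
  · exact not_holdsInDegree_thirty_of_char_151 K
  · exact not_holdsInDegree_thirtyOne_of_char_151 K
  · exact not_holdsInDegree_thirtyTwo_of_char_151 K
  · exact not_holdsInDegree_thirtyThree_of_char_151 K
  · exact not_holdsInDegree_thirtyFour_of_char_151 K
  · exact not_holdsInDegree_thirtyFive_of_char_151 K
  · exact not_holdsInDegree_thirtySix_of_char_151 K
  · exact not_holdsInDegree_thirtySeven_of_char_151 K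
  · exact not_holdsInDegree_thirtyEight_of_char_151 K
  · exact not_holdsInDegree_thirtyNine_of_char_151 K
  · exact not_holdsInDegree_forty_of_char_151 K
  · exact not_holdsInDegree_fortyOne_of_char_151 K
  · exact not_holdsInDegree_fortyTwo_of_char_151 K
  · exact not_holdsInDegree_fortyThree_of_char_151 K
  · exact not_holdsInDegree_of_choose_modEq_one K 151 (d := 44) (m := 8) (by norm_num) (by norm_num) (by decide)
  · exact not_holdsInDegree_fortyFive_of_char_151 K
  · exact not_holdsInDegree_fortySix_of_char_151 K
  · exact not_holdsInDegree_fortySeven_of_char_151 K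
  · exact not_holdsInDegree_fortyEight_of_char_151 K
  · exact not_holdsInDegree_of_choose_modEq_one K 151 (d := 49) (m := 23) (by norm_num) (by norm_num) (by decide)
  · exact not_holdsInDegree_fifty_of_char_151 K
  · exact not_holdsInDegree_fiftyOne_of_char_151 K
  · exact not_holdsInDegree_fiftyTwo_of_char_151 K
  · exact not_holdsInDegree_fiftyThree_of_char_151 K
  · exact not_holdsInDegree_fiftyFour_of_char_151 K
  · exact not_holdsInDegree_fiftyFive_of_char_151 K
  · exact not_holdsInDegree_fiftySix_of_char_151 K
  · exact not_holdsInDegree_of_choose_modEq_one K 151 (d := 57) (m := 21) (by norm_num) (by norm_num) (by decide)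
  · exact not_holdsInDegree_fiftyEight_of_char_151 K
  · exact not_holdsInDegree_of_choose_modEq_one K 151 (d := 59) (m := 27) (by norm_num) (by norm_num) (by decide)
  · exact not_holdsInDegree_sixty_of_char_151 K
  · exact not_holdsInDegree_sixtyOne_of_char_151 K
  · exact not_holdsInDegree_sixtyTwo_of_char_151 K
  · exact not_holdsInDegree_sixtyThree_of_char_151 K
  · exact not_holdsInDegree_sixtyFour_of_char_151 K
  · exact not_holdsInDegree_sixtyFive_of_char_151 K
  · exact not_holdsInDegree_sixtySix_of_char_151 K
  · exact not_holdsInDegree_sixtySeven_of_char_151 K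
  · exact not_holdsInDegree_sixtyEight_of_char_151 K
  · exact not_holdsInDegree_sixtyNine_of_char_151 K
  · exact not_holdsInDegree_seventy_of_char_151 K
  · exact not_holdsInDegree_of_choose_modEq_one K 151 (d := 71) (m := 25) (by norm_num) (by norm_num) (by decide)
  · exact not_holdsInDegree_seventyTwo_of_char_151 K
  · exact not_holdsInDegree_seventyThree_of_char_151 K
  · exact not_holdsInDegree_seventyFour_of_char_151 K
  · exact not_holdsInDegree_of_choose_modEq_one K 151 (d := 75) (m := 24) (by norm_num) (by norm_num) (by decide)
  · exact not_holdsInDegree_seventySix_of_char_151 K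
  · exact not_holdsInDegree_seventySeven_of_char_151 K
  · exact not_holdsInDegree_of_choose_modEq_one K 151 (d := 78) (m := 10) (by norm_num) (by norm_num) (by decide)
  · exact not_holdsInDegree_seventyNine_of_char_151 K
  · exact not_holdsInDegree_eighty_of_char_151 K
  · exact not_holdsInDegree_eightyOne_of_char_151 K
  · exact not_holdsInDegree_of_choose_modEq_one K 151 (d := 82) (m := 10) (by norm_num) (by norm_num) (by decide)
  · exact not_holdsInDegree_of_choose_modEq_one K 151 (d := 83) (m := 32) (by norm_num) (by norm_num) (by decide)
  · exact not_holdsInDegree_eightyFour_of_char_151 K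
  · exact not_holdsInDegree_eightyFive_of_char_151 K
  · exact not_holdsInDegree_eightySix_of_char_151 K
  · exact not_holdsInDegree_eightySeven_of_char_151 K
  · exact not_holdsInDegree_of_choose_modEq_one K 151 (d := 88) (m := 19) (by norm_num) (by norm_num) (by decide)
  · exact not_holdsInDegree_eightyNine_of_char_151 K
  · exact not_holdsInDegree_ninety_of_char_151 K
  · exact not_holdsInDegree_ninetyOne_of_char_151 K
  · exact not_holdsInDegree_ninetyTwo_of_char_151 K
  · exact not_holdsInDegree_ninetyThree_of_char_151 K
  · exact not_holdsInDegree_ninetyFour_of_char_151 K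
  · exact not_holdsInDegree_ninetyFive_of_char_151 K
  · exact not_holdsInDegree_ninetySix_of_char_151 K
  · exact not_holdsInDegree_ninetySeven_of_char_151 K
  · exact not_holdsInDegree_ninetyEight_of_char_151 K
  · exact not_holdsInDegree_of_choose_modEq_one K 151 (d := 99) (m := 24) (by norm_num) (by norm_num) (by decide)
  · exact not_holdsInDegree_oneHundred_of_char_151 K
  · exact not_holdsInDegree_oneHundredOne_of_char_151 K
  · exact not_holdsInDegree_of_choose_modEq_one K 151 (d := 102) (m := 37) (by norm_num) (by norm_num) (by decide)
  · exact not_holdsInDegree_oneHundredThree_of_char_151 K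
  · exact not_holdsInDegree_oneHundredFour_of_char_151 K
  · exact not_holdsInDegree_oneHundredFive_of_char_151 K
  · exact not_holdsInDegree_oneHundredSix_of_char_151 K
  · exact not_holdsInDegree_oneHundredSeven_of_char_151 K
  · exact not_holdsInDegree_oneHundredEight_of_char_151 K
  · exact not_holdsInDegree_oneHundredNine_of_char_151 K
  · exact not_holdsInDegree_of_choose_modEq_one K 151 (d := 110) (m := 7) (by norm_num) (by norm_num) (by decide)
  · exact not_holdsInDegree_oneHundredEleven_of_char_151 K
  · exact not_holdsInDegree_oneHundredTwelve_of_char_151 K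
  · exact not_holdsInDegree_oneHundredThirteen_of_char_151 K
  · exact not_holdsInDegree_of_choose_modEq_one K 151 (d := 114) (m := 8) (by norm_num) (by norm_num) (by decide)
  · exact not_holdsInDegree_oneHundredFifteen_of_char_151 K
  · exact not_holdsInDegree_oneHundredSixteen_of_char_151 K
  · exact not_holdsInDegree_oneHundredSeventeen_of_char_151 K
  · exact not_holdsInDegree_oneHundredEighteen_of_char_151 K
  · exact not_holdsInDegree_oneHundredNineteen_of_char_151 K
  · exact not_holdsInDegree_oneHundredTwenty_of_char_151 K
  · exact not_holdsInDegree_oneHundredTwentyOne_of_char_151 K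
  · exact not_holdsInDegree_oneHundredTwentyTwo_of_char_151 K
  · exact not_holdsInDegree_of_choose_modEq_one K 151 (d := 123) (m := 32) (by norm_num) (by norm_num) (by decide)
  · exact not_holdsInDegree_oneHundredTwentyFour_of_char_151 K
  · exact not_holdsInDegree_of_choose_modEq_one K 151 (d := 125) (m := 46) (by norm_num) (by norm_num) (by decide)
  · exact not_holdsInDegree_oneHundredTwentySix_of_char_151 K
  · exact not_holdsInDegree_of_choose_modEq_one K 151 (d := 127) (m := 21) (by norm_num) (by norm_num) (by decide)
  · exact not_holdsInDegree_of_choose_modEq_one K 151 (d := 128) (m := 4) (by norm_num) (by norm_num) (by decide)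
  · exact not_holdsInDegree_of_choose_modEq_one K 151 (d := 129) (m := 23) (by norm_num) (by norm_num) (by decide)
  · exact not_holdsInDegree_of_choose_modEq_one K 151 (d := 130) (m := 7) (by norm_num) (by norm_num) (by decide)
  · exact not_holdsInDegree_oneHundredThirtyOne_of_char_151 K
  · exact not_holdsInDegree_oneHundredThirtyTwo_of_char_151 K
  · exact not_holdsInDegree_oneHundredThirtyThree_of_char_151 K
  · exact not_holdsInDegree_oneHundredThirtyFour_of_char_151 K
  · exact not_holdsInDegree_oneHundredThirtyFive_of_char_151 K
  · exact not_holdsInDegree_oneHundredThirtySix_of_char_151 K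
  · exact not_holdsInDegree_oneHundredThirtySeven_of_char_151 K
  · exact not_holdsInDegree_oneHundredThirtyEight_of_char_151 K
  · exact not_holdsInDegree_oneHundredThirtyNine_of_char_151 K
  · exact not_holdsInDegree_of_choose_modEq_one K 151 (d := 140) (m := 68) (by norm_num) (by norm_num) (by decide)
  · exact not_holdsInDegree_oneHundredFortyOne_of_char_151 K
  · exact not_holdsInDegree_of_choose_modEq_one K 151 (d := 142) (m := 9) (by norm_num) (by norm_num) (by decide)
  · exact not_holdsInDegree_oneHundredFortyThree_of_char_151 K
  · exact not_holdsInDegree_oneHundredFortyFour_of_char_151 K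
  · exact not_holdsInDegree_of_choose_modEq_one K 151 (d := 145) (m := 14) (by norm_num) (by norm_num) (by decide)
  · exact not_holdsInDegree_of_choose_modEq_one K 151 (d := 146) (m := 22) (by norm_num) (by norm_num) (by decide)
  · exact not_holdsInDegree_oneHundredFortySeven_of_char_151 K
  · exact not_holdsInDegree_oneHundredFortyEight_of_char_151 K
  · exact not_holdsInDegree_oneHundredFortyNine_of_char_151 K
  · exact not_holdsInDegree_of_choose_modEq_one K 151 (d := 150) (m := 2) (by norm_num) (by norm_num) (by decide)

/-- the positive digits `1 ≤ a ≤ 5`: `CA_{a·151^k}` over every field of characteristic `151`. [cite: GrafVonBothmerEtAl2007, Props. 2, 6]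
[cite: CastryckLaterveerOunaies2012, Thm. 4] -/
theorem holdsInDegree_mul_oneHundredFiftyOne_pow_of_le_five {a : ℕ} (ha0 : 0 < a) (ha5 : a ≤ 5) (k : ℕ) :
    HoldsInDegree K (a * 151 ^ k) := by
  haveI : Fact (Nat.Prime 151) := ⟨by norm_num⟩
  interval_cases a
  · simpa using holdsInDegree_prime_pow_field K 151 k
  · exact holdsInDegree_two_mul_prime_pow_field K 151 k
  · exact holdsInDegree_three_mul_prime_pow_field K 151 (by norm_num) k
  · exact holdsInDegree_mul_prime_pow_field K 151
      (holdsInDegree_of_le_four_of_charP (AlgebraicClosure K) 151 (by norm_num) le_rfl) k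
  · exact holdsInDegree_five_mul_prime_pow_field K 151 (by norm_num) (by norm_num) (by norm_num) (by norm_num)
      (by norm_num) (by norm_num) (by norm_num) (by norm_num) (by norm_num) k

/-- **characteristic 151, complete**: over every field of characteristic `151`,
`CA_d ⟺ d = 0 ∨ d = a·151^k` with `1 ≤ a ≤ 7`. [cite: GrafVonBothmerEtAl2007, Props. 2, 6, 7]
[cite: CastryckLaterveerOunaies2012, Thm. 4] -/
theorem classification_char_oneHundredFiftyOne_complete (d : ℕ) :
    HoldsInDegree K d ↔ d = 0 ∨ ∃ k a : ℕ, 0 < a ∧ a ≤ 7 ∧ d = a * 151 ^ k := by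
  haveI : Fact (Nat.Prime 151) := ⟨by norm_num⟩
  constructor
  · intro h
    rcases Nat.eq_zero_or_pos d with rfl | hd
    · exact Or.inl rfl
    obtain ⟨k, a, ha0, hap, rfl, ha⟩ := digit_of_holdsInDegree K 151 hd.ne' h
    refine Or.inr ⟨k, a, ha0, ?_, rfl⟩
    by_contra h7
    exact not_holdsInDegree_digit_of_char_oneHundredFiftyOne K (by omega) hap ha
  · rintro (rfl | ⟨k, a, ha0, ha7, rfl⟩)
    · exact holdsInDegree_zero K
    · rcases Nat.lt_or_ge a 6 with ha | ha
      · exact holdsInDegree_mul_oneHundredFiftyOne_pow_of_le_five K ha0 (by omega) k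
      · rcases Nat.lt_or_ge a 7 with ha' | ha'
        · obtain rfl : a = 6 := by omega
          exact holdsInDegree_six_mul_pow_of_char_151' K k
        · obtain rfl : a = 7 := le_antisymm ha7 ha'
          exact holdsInDegree_seven_mul_pow_of_char_151 (K := K) k

/-- the set of Casas-Alvero degrees `≤ 22801` in characteristic `151`, explicitly (corollary of the classification:
[cite: GrafVonBothmerEtAl2007, Prop. 6] with [cite: CastryckLaterveerOunaies2012, Thm. 4] and the digit refutations above). -/
theorem holdsInDegree_iff_mem_of_le_char_oneHundredFiftyOne_sq {d : ℕ} (hd : d ≤ 22801) :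
    HoldsInDegree K d ↔ d ∈ ({0, 1, 2, 3, 4, 5, 6, 7, 151, 302, 453, 604, 755, 906, 1057, 22801} : Finset ℕ) := by
  rw [classification_char_oneHundredFiftyOne_complete]
  constructor
  · rintro (rfl | ⟨k, a, ha0, ha7, rfl⟩)
    · decide
    · rcases k with _ | _ | _ | k
      · interval_cases a <;> decide
      · interval_cases a <;> decide
      · interval_cases a <;> simp_all
      · exfalso
        have : 151 ^ 3 ≤ a * 151 ^ (k + 1 + 1 + 1) :=
          le_trans (Nat.pow_le_pow_right (by norm_num) (by omega)) (Nat.le_mul_of_pos_left _ ha0)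
        omega
  · intro h
    simp only [Finset.mem_insert, Finset.mem_singleton] at h
    rcases h with rfl | rfl | rfl | rfl | rfl | rfl | rfl | rfl | rfl | rfl | rfl | rfl | rfl | rfl | rfl | rfl
    · exact Or.inl rfl
    · exact Or.inr ⟨0, 1, by norm_num, by norm_num, by norm_num⟩
    · exact Or.inr ⟨0, 2, by norm_num, by norm_num, by norm_num⟩
    · exact Or.inr ⟨0, 3, by norm_num, by norm_num, by norm_num⟩
    · exact Or.inr ⟨0, 4, by norm_num, by norm_num, by norm_num⟩
    · exact Or.inr ⟨0, 5, by norm_num, by norm_num, by norm_num⟩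
    · exact Or.inr ⟨0, 6, by norm_num, by norm_num, by norm_num⟩
    · exact Or.inr ⟨0, 7, by norm_num, by norm_num, by norm_num⟩
    · exact Or.inr ⟨1, 1, by norm_num, by norm_num, by norm_num⟩
    · exact Or.inr ⟨1, 2, by norm_num, by norm_num, by norm_num⟩
    · exact Or.inr ⟨1, 3, by norm_num, by norm_num, by norm_num⟩
    · exact Or.inr ⟨1, 4, by norm_num, by norm_num, by norm_num⟩
    · exact Or.inr ⟨1, 5, by norm_num, by norm_num, by norm_num⟩
    · exact Or.inr ⟨1, 6, by norm_num, by norm_num, by norm_num⟩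
    · exact Or.inr ⟨1, 7, by norm_num, by norm_num, by norm_num⟩
    · exact Or.inr ⟨2, 1, by norm_num, by norm_num, by norm_num⟩

end CharOneHundredFiftyOne

end Literature.Algebra.Polynomial.CasasAlvero
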